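import Literature.NumberTheory.GaloisRepresentations.GaloisCohomology
import HarnessLib

/-!
# Division along a surjection of discrete Galois modules: the map `T/IT ↪ T/JT`, `x ↦ s·x`, of `Quot(T)` from the
# reduction `T/JT ↠ T/IT` (one definition with body + theorems; no named fact, no instance, no notation)

Topic `NumberTheory/GaloisRepresentations`. For an equivariant SURJECTION `r : V ↠ V'` of discrete Galois modules and a
natural number `n` killing `ker r`, there is a unique additive map `g : V' → V` with `g (r x) = n • x`; it is continuous
and equivariant (`DiscreteGaloisModule.divIntertwining`), with `r ∘ g = n • id`, range `n • V`, and it is injective as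
soon as `V[n] ⊆ ker r`.  This is how the injective morphisms of Howard's category `Quot(T)` [Howard 2004, Def. 1.1.3,
arXiv 1202.6340 Def. 2.1.3: «objects the quotients `T/IT`, morphisms `T/IT → T/JT` induced by `r ∈ R` with `rI ⊂ J`»]
are realised on a `p`-adic tower given only by its reductions: `×p^{b−a} : T/p^a ↪ T/p^b` is the division along
`T/p^b ↠ T/p^a` (consumer: `EllipticCurves/ZpExtensionEisensteinTowerDivisionProofs`, the two-index maps of the
Eisenstein tower; cell `pub/bsd-print-x9`).

References: [Howard2004HeegnerKolyvagin] Def. 1.1.3 (arXiv Def. 2.1.3, p. 5); [MazurRubinMemoirs2004] §1.1;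
[SerreGaloisCohomology1997] I §2.2. BSD is not proved by any of this.
-/

noncomputable section

open scoped ContRepresentation
open Function

/-! ## §1 Division along a surjection of discrete Galois modules -/

namespace Literature.NumberTheory.GaloisRepresentations.DiscreteGaloisModule

variable {K : Type} [Field K] {V V' : Type} [AddCommGroup V] [TopologicalSpace V] [DiscreteTopology V]
  [AddCommGroup V'] [TopologicalSpace V'] [DiscreteTopology V']
  {ρ : DiscreteGaloisModule K V} {ρ' : DiscreteGaloisModule K V'}

/-- **Division along a surjection.** For an equivariant surjection `r : V ↠ V'` of discrete Galois modules and `n` with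
`n • ker r = 0`, the unique additive map `g : V' → V` with `g (r x) = n • x` (`y ↦ n • x` for any `x` over `y`; well
defined, additive and equivariant because `n` kills `ker r`) — the map `T/p^a ↪ T/p^b`, `x ↦ p^{b−a} x`, of `Quot(T)`
when `r = (T/p^b ↠ T/p^a)`. [cite: Howard2004HeegnerKolyvagin, Def. 1.1.3 (arXiv Def. 2.1.3: the morphisms of Quot(T))] -/
def divIntertwining (r : ρ.toContRepresentation →ⁱL ρ'.toContRepresentation) (hr : Surjective r) (n : ℕ)
    (hn : ∀ x, r x = 0 → n • x = 0) : ρ'.toContRepresentation →ⁱL ρ.toContRepresentation where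
  toContinuousLinearMap :=
    ⟨(AddMonoidHom.mk' (fun y ↦ n • surjInv hr y) fun y y' ↦ by
        have h : r (surjInv hr (y + y') - surjInv hr y - surjInv hr y') = 0 := by
          rw [map_sub, map_sub, surjInv_eq hr, surjInv_eq hr, surjInv_eq hr, add_sub_cancel_left, sub_self]
        have h' := hn _ h
        rw [smul_sub, smul_sub, sub_sub, sub_eq_zero] at h'
        exact h').toIntLinearMap, continuous_of_discreteTopology⟩
  isIntertwining' σ := by
    refine ContinuousLinearMap.ext fun y ↦ ?_
    change n • surjInv hr (ρ' σ y) = ρ σ (n • surjInv hr y)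
    have h : r (surjInv hr (ρ' σ y) - ρ σ (surjInv hr y)) = 0 := by
      rw [map_sub, surjInv_eq hr, show r (ρ σ (surjInv hr y)) = ρ' σ (r (surjInv hr y)) from
        congrArg (fun φ ↦ φ (surjInv hr y)) (r.isIntertwining' σ), surjInv_eq hr, sub_self]
    have h' := hn _ h
    rw [smul_sub, sub_eq_zero] at h'
    rw [h', map_nsmul]

/-- Unfolding: `div y = n • s y` for the chosen section `s = surjInv`. [cite: Howard2004HeegnerKolyvagin, Def. 1.1.3] -/
theorem divIntertwining_apply (r : ρ.toContRepresentation →ⁱL ρ'.toContRepresentation) (hr : Surjective r)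
    (n : ℕ) (hn : ∀ x, r x = 0 → n • x = 0) (y : V') : divIntertwining r hr n hn y = n • surjInv hr y := rfl

/-- The defining identity: `div (r x) = n • x`. [cite: Howard2004HeegnerKolyvagin, Def. 1.1.3] -/
theorem divIntertwining_apply_apply (r : ρ.toContRepresentation →ⁱL ρ'.toContRepresentation) (hr : Surjective r)
    (n : ℕ) (hn : ∀ x, r x = 0 → n • x = 0) (x : V) : divIntertwining r hr n hn (r x) = n • x := by
  rw [divIntertwining_apply]
  have h : r (surjInv hr (r x) - x) = 0 := by rw [map_sub, surjInv_eq hr, sub_self]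
  have h' := hn _ h
  rwa [smul_sub, sub_eq_zero] at h'

/-- `r (div y) = n • y`. [cite: Howard2004HeegnerKolyvagin, Def. 1.1.3] -/
theorem apply_divIntertwining (r : ρ.toContRepresentation →ⁱL ρ'.toContRepresentation) (hr : Surjective r)
    (n : ℕ) (hn : ∀ x, r x = 0 → n • x = 0) (y : V') : r (divIntertwining r hr n hn y) = n • y := by
  obtain ⟨x, rfl⟩ := hr y
  rw [divIntertwining_apply_apply, map_nsmul]

/-- **Uniqueness**: any function `g` with `g (r x) = n • x` for all `x` is the division map.
[cite: Howard2004HeegnerKolyvagin, Def. 1.1.3] -/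
theorem eq_divIntertwining_apply (r : ρ.toContRepresentation →ⁱL ρ'.toContRepresentation) (hr : Surjective r)
    (n : ℕ) (hn : ∀ x, r x = 0 → n • x = 0) {g : V' → V} (hg : ∀ x, g (r x) = n • x) (y : V') :
    g y = divIntertwining r hr n hn y := by
  obtain ⟨x, rfl⟩ := hr y
  rw [hg, divIntertwining_apply_apply]

/-- The range of the division map is `n • V`. [cite: Howard2004HeegnerKolyvagin, Def. 1.1.3] -/
theorem exists_divIntertwining_eq_iff (r : ρ.toContRepresentation →ⁱL ρ'.toContRepresentation) (hr : Surjective r)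
    (n : ℕ) (hn : ∀ x, r x = 0 → n • x = 0) (z : V) :
    (∃ y, divIntertwining r hr n hn y = z) ↔ ∃ x : V, z = n • x := by
  constructor
  · rintro ⟨y, rfl⟩
    obtain ⟨x, rfl⟩ := hr y
    exact ⟨x, divIntertwining_apply_apply r hr n hn x⟩
  · rintro ⟨x, rfl⟩
    exact ⟨r x, divIntertwining_apply_apply r hr n hn x⟩

/-- **Injectivity criterion**: the division map is injective as soon as `V[n] ⊆ ker r` (i.e. `V[n] = ker r`, the
torsion exactness of a free level). [cite: Howard2004HeegnerKolyvagin, Def. 1.1.3] -/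
theorem divIntertwining_injective (r : ρ.toContRepresentation →ⁱL ρ'.toContRepresentation) (hr : Surjective r)
    (n : ℕ) (hn : ∀ x, r x = 0 → n • x = 0) (htors : ∀ x, n • x = 0 → r x = 0) :
    Injective (divIntertwining r hr n hn) := by
  intro y y' h
  obtain ⟨x, rfl⟩ := hr y
  obtain ⟨x', rfl⟩ := hr y'
  rw [divIntertwining_apply_apply, divIntertwining_apply_apply, ← sub_eq_zero, ← smul_sub] at h
  rw [← sub_eq_zero, ← map_sub]
  exact htors _ h

end Literature.NumberTheory.GaloisRepresentations.DiscreteGaloisModule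

end
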